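/-
COR-CM (cell pub-hodgecm2, stage 2 of the Hodge ladder) — count-neutral kernel combinatorics (seat prover-pub-hodgecm2-b23-g40-0, binder
prover b23, gen 40; claim COMPLEMENT-FACES F8, HOME/INBOX.md l.9766/l.9940; sequel of `Census/ComplementFacesGenerate.lean`).  Theorems only, in
seat b09's intrinsic model (`CMF G c`, `gfaceSet`, `pairSet`, `translates`, `hodgeSpan`, `Block`, `fibreTwo` — consumed BY NAME, nothing
restated) plus Mathlib's sign of a permutation; no definition, no certificate, no `decide`, no named fact, no geometry, no `sorry`.
`Interfaces.lean` (C1), every E term, B01 and `Transposition/*` are untouched.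
HONEST FRAMING: `HC_CM` is NOT proved, here or anywhere in the tree; nothing here is a period or a headline.
-/
import Summits.HodgeConjecture.CorCM.Census.ComplementFacesGenerate
import Mathlib.GroupTheory.Perm.Cycle.Type

/-!
# Faces of a complemented Galois CM type, VII: odd half-order — an involution is ALWAYS complemented, so `μ = β − 1` for every `(G, c)`
# with `|G|/2` odd

If `|G| = 2m` with `m` odd, every involution `c` of `G` has a complement (**`exists_cpl_of_odd_half`**): the sign of the left-regular
permutation representation is a homomorphism `G → ℤˣ` taking `c` (a product of `m` disjoint transpositions, `m` odd) to `−1`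
(`Equiv.Perm.sign_of_pow_two_eq_one`); its kernel is a subgroup of index two missing `c`, i.e. a complement (seat b09's
`Coinvariant.cpl_of_index_two`).  Hence part V (`exists_gfaces_generate_of_cpl_odd_card_eq`, BY NAME with the complement of §2) applies with NO complement hypothesis (**`isLeast_card_gfaces_generate_of_odd_half`**, **`exists_gfaceSet_subset_of_odd_half`**): for every
finite group `G` with `|G|/2` odd and every central involution `c ≠ 1`, the least number of face relations whose base changes generate
`hodgeSpan c` modulo pairs is EXACTLY `β(G, c) − 1 = φ₂(G, c)` — the existence half of seat b09's ODD-HALF COINVARIANT THEOREM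
(`Coinvariant.fibreTwo_add_one_eq_card_block_of_odd_half`: `φ₂ + 1 = β` whenever `|G|/2` is odd), attained by faces, for every Galois CM type of
order `≡ 2 (mod 4)` (abelian or not: `ℤ/2 × A` for ANY `A` of odd order).  The field form is `CorCM/FaceComplementImaginaryQuadratic.lean` §2.
All [folklore] bookkeeping over [Pohlmann1968, Thm 1] in the reading of [Milne1999, Prop. 2.1].

## References
* [Pohlmann1968] H. Pohlmann, Algebraic cycles on abelian varieties of complex multiplication type, Ann. of Math. 88 (1968), Thm 1.
* [Milne1999] J. S. Milne, Lefschetz motives and the Tate conjecture, Compositio Math. 117 (1999), Prop. 2.1, p. 54.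
-/

namespace Summit.HodgeConjecture.CorCM.Census.ComplementFaces

open Finset
open Summit.HodgeConjecture.CorCM.Prior.AllgGroup.RfwfAllgGroup
open Summit.HodgeConjecture.CorCM.Census.BlockParity
open Summit.HodgeConjecture.CorCM.Census.Coinvariant

noncomputable section

variable {G : Type*} [Group G] [Fintype G] [DecidableEq G] (c : G)

/-! ## §1 The sign of left multiplication by an involution -/

omit [Fintype G] [DecidableEq G] in
/-- Left multiplication by an involution has square `1` as a permutation. [folklore] -/
theorem toPerm_mul_self (hc2 : c * c = 1) : (MulAction.toPermHom G G c) ^ 2 = 1 := by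
  rw [← map_pow, pow_two, hc2, map_one]

/-- Left multiplication by `c ≠ 1` has no fixed points. [folklore] -/
theorem card_fixedPoints_toPerm (hc1 : c ≠ 1) : Fintype.card (Function.fixedPoints (MulAction.toPermHom G G c)) = 0 := by
  rw [Fintype.card_eq_zero_iff]
  refine ⟨fun ⟨x, hx⟩ => hc1 ?_⟩
  have h : c * x = x := hx
  exact mul_right_cancel (h.trans (one_mul x).symm)

/-- **For `|G|/2` odd the sign of left multiplication by an involution `≠ 1` is `−1`** (it is `(−1)^{|G|/2}`:
`Equiv.Perm.sign_of_pow_two_eq_one`, no fixed points). [folklore] -/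
theorem sign_toPerm_eq_neg_one (hc2 : c * c = 1) (hc1 : c ≠ 1) (hodd : Odd (Fintype.card G / 2)) :
    Equiv.Perm.sign (MulAction.toPermHom G G c) = -1 := by
  have h := Equiv.Perm.sign_of_pow_two_eq_one (toPerm_mul_self c hc2)
  rw [card_fixedPoints_toPerm c hc1, Nat.sub_zero] at h
  rw [h]
  exact hodd.neg_one_pow

/-! ## §2 The complement of an involution in a group of twice odd order -/

/-- **An involution `≠ 1` of a finite group with `|G|/2` odd has a complement**: the kernel of the sign of the regular representation is a
subgroup of index two missing `c`. [folklore] -/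
theorem exists_cpl_of_odd_half (hc2 : c * c = 1) (hc1 : c ≠ 1) (hodd : Odd (Fintype.card G / 2)) :
    ∃ A : Subgroup G, ∀ x : G, x ∈ A ↔ c * x ∉ A := by
  set φ : G →* ℤˣ := Equiv.Perm.sign.comp (MulAction.toPermHom G G) with hφ
  have hφc : φ c = -1 := by rw [hφ, MonoidHom.comp_apply, sign_toPerm_eq_neg_one c hc2 hc1 hodd]
  have hsurj : Function.Surjective φ := by
    intro u
    rcases Int.units_eq_one_or u with rfl | rfl
    · exact ⟨1, map_one φ⟩
    · exact ⟨c, hφc⟩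
  have hidx : φ.ker.index = 2 := by
    rw [Subgroup.index_ker, MonoidHom.range_eq_top.mpr hsurj, Subgroup.card_top, Nat.card_eq_fintype_card, Fintype.card_units_int]
  have hcK : c ∉ φ.ker := by
    rw [MonoidHom.mem_ker, hφc]
    decide
  exact ⟨φ.ker, cpl_of_index_two c hidx hcK⟩

/-! ## §3 `μ = β − 1` for every `(G, c)` with `|G|/2` odd -/

/-- **`μ(G, c) = β(G, c) − 1 = φ₂(G, c)` EXACTLY for every finite group with `|G|/2` odd and every central involution `c ≠ 1`** — the
existence half of seat b09's odd-half coinvariant theorem, attained by faces. [folklore] -/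
theorem isLeast_card_gfaces_generate_of_odd_half (hc2 : c * c = 1) (hc1 : c ≠ 1) (hcen : ∀ x : G, x * c = c * x)
    (hodd : Odd (Fintype.card G / 2)) :
    IsLeast {m : ℕ | ∃ S : Finset (CMF G c →₀ ℤ), (↑S ⊆ gfaceSet G c hc2) ∧ S.card = m ∧
      hodgeSpan c hc2 ≤ Submodule.span ℤ (pairSet c) ⊔ Submodule.span ℤ (translates c S)}
      (Fintype.card (Block c) - 1) := by
  have hβ := fibreTwo_add_one_eq_card_block_of_odd_half c hc2 hc1 hcen hodd
  obtain ⟨A, hA⟩ := exists_cpl_of_odd_half c hc2 hc1 hodd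
  constructor
  · obtain ⟨S, hS, hcard, -, hgen⟩ := exists_gfaces_generate_of_cpl_odd_card_eq c hA hc2 hc1 hcen hodd
    exact ⟨S, hS, by omega, hgen⟩
  · rintro m ⟨S, hS, rfl, hgen⟩
    have hfloor := fibreTwo_le_card_of_faces c hc2 hcen S hS fun y hy => hgen (gfaceSet_subset_hodgeSpan c hc2 hy)
    omega

/-- **The face form** for `|G|/2` odd: `β − 1` face relations with `faces ⊆ ℤ⟨pairs⟩ + ℤ⟨their base changes⟩`. [folklore] -/
theorem exists_gfaceSet_subset_of_odd_half (hc2 : c * c = 1) (hc1 : c ≠ 1) (hcen : ∀ x : G, x * c = c * x)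
    (hodd : Odd (Fintype.card G / 2)) :
    ∃ S : Finset (CMF G c →₀ ℤ), (↑S ⊆ gfaceSet G c hc2) ∧ S.card + 1 = Fintype.card (Block c) ∧
      gfaceSet G c hc2 ⊆ ↑(Submodule.span ℤ (pairSet c) ⊔ Submodule.span ℤ (translates c S)) := by
  obtain ⟨A, hA⟩ := exists_cpl_of_odd_half c hc2 hc1 hodd
  obtain ⟨S, hS, hcard, -, hgen⟩ := exists_gfaces_generate_of_cpl_odd_card_eq c hA hc2 hc1 hcen hodd
  exact ⟨S, hS, hcard, fun y hy => hgen (gfaceSet_subset_hodgeSpan c hc2 hy)⟩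

end

end Summit.HodgeConjecture.CorCM.Census.ComplementFaces
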